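import Literature.MathematicalPhysics.QuantumFieldTheory.BalabanImbrieJaffe1984to88.BIJ88RestrictionsAllOrders308
import Literature.MathematicalPhysics.QuantumFieldTheory.BalabanImbrieJaffe1984to88.BIJ88InterpolatedRestrictions308
import Mathlib.Analysis.SpecialFunctions.Log.Deriv

/-!
# `BalabanImbrieJaffe1984to88.BIJ88RestrictedInteraction308` — T. Bałaban, J. Imbrie, A. Jaffe, *Effective action and cluster
properties of the abelian Higgs model*, Commun. Math. Phys. **114** (1988) 257–315 [BalabanImbrieJaffe1988]: Sect. 5.14, p. 308 [PDF 52],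
verbatim: *"Define z_t(Λ₁₂^{(k)}) for t ∈ [0,1] by replacing Ṽ(Λ₁₂^{(k)}) with tṼ(Λ₁₂^{(k)}), replacing χ(cp(e_k), (I−Q^{s*}Q)A^{(k)}) with
χ(cp(te_k), (I−Q^{s*}Q)A^{(k)}), and similarly for χ(cp(e_k), φ^{(k)}). Thus the restrictions and the interactions disappear at t = 0,
at which point we have a purely Gaussian expectation. Thus we define perturbative terms for the action,
𝒫_{k+1} = Σ_{α=1}^{n̄} −(1/α!)(dᵅ/dtᵅ) log z_t|_{t=0}"* (5.14.1)/(5.14.2) — BOTH INTERPOLATIONS AT ONCE: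
`z(t) = ∫ χ′_{Λ,t}·e^{−tṼ} dμ`, `χ′_{Λ,t} = Π_{b∈B} χ(c_b·p(te_k), Φ_b)`.

statement-level skeleton of published theorems with citation tags; proofs where landed; nothing here is a claim about the Yang–Mills mass gap

ERRATUM (v1.1, docstring only; referee ref-1 gen 27/28, render `lit-balaban-r16/renders/cmp114/original-p052-x2.png`): print's
(5.14.1) carries a leading MINUS — 𝒫_{k+1}(Λ₁₂^{(k)}) = Σ_{α=1}^{n̄} −(1/α!)(dᵅ/dtᵅ) log z_t(Λ₁₂^{(k)})|_{t=0} — and so does the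
remainder (5.14.2), ℛ_k(Λ₁₂^{(k)}) = ∫₀¹ dt −((1−t)^{n̄}/(n̄+1)!)⟨d/dt; …; d/dt⟩_t; the v1 quotation dropped the sign.  Declarations are
unchanged (the minus lives inside `BIJ88Perturbative341.pertPart`).
Consequently print's α = 1 term is −(d/dt) log z_t|_{t=0} = +⟨Ṽ⟩₀: the v1 gloss «the α = 1 term of (5.14.1) is ⟨−Ṽ⟩»
below refers to the derivative (d/dt) log z_t|₀ = ⟨−Ṽ⟩₀ itself (`tendsto_deriv_log_restrictedInteraction_zero`), print's
term being its negative.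

WHAT THIS FILE ADDS.  `BIJ88Perturbative341` treats the interaction family `∫ e^{−tW} dμ` (bounded `W`; `log z_t` = Mathlib's `cgf`,
`(d/dt) log z_t = ⟨−W⟩_t`) and notes that the χ′-interpolation is not covered by it; `BIJ88InterpolatedRestrictions308` /
`…AllOrders308` / `BIJ88LogZt308` treat the restriction family alone.  Here the two are COMBINED at first order (α = 1 of (5.14.1)),
for ANY finite measure, measurable fields and a measurable interaction `|W| ≤ K`:
* §1–§2 `z′(t₀) = ∫ [(∂_tχ′_{Λ,t})·e^{−tW} − W·χ′_{Λ,t}·e^{−tW}]_{t₀} dμ` on the branch `0 < t₀`, `t₀e_k < e^{−1}` — differentiation under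
  the integral sign (`hasDerivAt_integral_restrictedInteraction`).
* §3 as `t → 0⁺`: `z(t) → μ(Ω)`; `∫ W χ′_{Λ,t} e^{−tW} dμ → ∫ W dμ` (dominated convergence); and with CENTERED GAUSSIAN marginals (Mathlib
  `HasGaussianLaw`, variances `≤ v`, `|c_b| ≥ c₀ > 0`, `p > 1/2`) the restriction term `∫ (∂_tχ′_{Λ,t}) e^{−tW} dμ → 0`
  (the Gaussian factor `t^{−1}e^{−κp(te_k)²} → 0` beats `e^{tK}`).
* §4 for a probability measure `(d/dt) log z_t → −∫ W dP` as `t → 0⁺` (`tendsto_deriv_log_restrictedInteraction_zero`): the α = 1 term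
  of (5.14.1) is the Gaussian (`t = 0`) expectation `⟨−Ṽ⟩`, the restrictions contributing nothing — the two quoted sentences combined.

PDF held: `paper:balaban1988-cmp114-bij-abelian-higgs-effective-action` (journal page = PDF page + 256); p. 308 [PDF 52].

CITATION HEADER (lean-in-tree rule).  Part of the lit-balaban TYPED SKELETON (HOME `run/shared/lean/pub/lit-balaban/`), Phase 2,
seat p36 (gen 7, unit `lit-balaban-p36`); row **C2.Eq5.14.1-5.14.2** of `HOME/lit-balaban-r16/ROWS-C2-part2.md` (owner r16; typed leaves
`Eq5141`/`Eq5142` untouched).  Theorems only; no definitions, no `Prop` facts; axioms standard.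
-/

namespace Literature.MathematicalPhysics.QuantumFieldTheory.BalabanImbrieJaffe1984to88.BIJ88RestrictedInteraction308

open MeasureTheory ProbabilityTheory Filter Set
open BIJ88Sect2Statements (pLog eK)
open BIJ88Sect5Statements (CutoffProfile cutoff)
open scoped Topology

/-! ## §1 The integrand `χ′_{Λ,t}(Φ(ω))·e^{−tW(ω)}` -/

section Integrand

variable (χ : CutoffProfile) {ι Ω : Type*} [MeasurableSpace Ω]

/-- Measurability of `ω ↦ χ′_{Λ,t}(Φ(ω))·e^{−tW(ω)}`. [cite: BalabanImbrieJaffe1988, (5.14.2) p.308] -/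
theorem measurable_restrictedInteraction (p : ℝ) (B : Finset ι) {Φ : ι → Ω → ℝ} (hΦ : ∀ b ∈ B, Measurable (Φ b)) (c : ι → ℝ)
    {W : Ω → ℝ} (hW : Measurable W) (ek t : ℝ) :
    Measurable fun ω => (∏ b ∈ B, cutoff χ (c b * pLog p (t * ek)) (Φ b ω)) * Real.exp (-(t * W ω)) :=
  (BIJ88InterpolatedRestrictions308.measurable_prod_cutoff_t χ p B hΦ c ek t).mul
    (Real.measurable_exp.comp (hW.const_mul t).neg)

/-- `|χ′_{Λ,t}·e^{−tW}| ≤ e^{tK}` for `|W| ≤ K`, `0 ≤ t`. [cite: BalabanImbrieJaffe1988, (5.14.2) p.308] -/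
theorem abs_restrictedInteraction_le (p : ℝ) (B : Finset ι) (A c : ι → ℝ) {K w : ℝ} (hw : |w| ≤ K) {ek t : ℝ} (ht : 0 ≤ t) :
    |(∏ b ∈ B, cutoff χ (c b * pLog p (t * ek)) (A b)) * Real.exp (-(t * w))| ≤ Real.exp (t * K) := by
  rw [abs_mul, Real.abs_exp]
  have h1 := BIJ88InterpolatedRestrictions308.abs_prod_cutoff_t_le_one χ p B A c ek t
  have h2 : Real.exp (-(t * w)) ≤ Real.exp (t * K) := by
    apply Real.exp_le_exp.mpr
    have : -w ≤ K := (neg_le_abs w).trans hw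
    nlinarith
  calc |∏ b ∈ B, cutoff χ (c b * pLog p (t * ek)) (A b)| * Real.exp (-(t * w)) ≤ 1 * Real.exp (t * K) :=
        mul_le_mul h1 h2 (Real.exp_pos _).le zero_le_one
    _ = Real.exp (t * K) := one_mul _

/-- `e^{−tw} ≤ e^{max(K,0)}` for `|w| ≤ K`, `0 ≤ t ≤ 1`. [cite: BalabanImbrieJaffe1988, (5.14.2) p.308] -/
theorem exp_neg_mul_le_exp_max {K w t : ℝ} (hw : |w| ≤ K) (ht0 : 0 ≤ t) (ht1 : t ≤ 1) :
    Real.exp (-(t * w)) ≤ Real.exp (max K 0) := by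
  apply Real.exp_le_exp.mpr
  have h1' : -w ≤ K := (neg_le_abs _).trans hw
  calc -(t * w) = t * -w := by ring
    _ ≤ t * max K 0 := mul_le_mul_of_nonneg_left (h1'.trans (le_max_left _ _)) ht0
    _ ≤ 1 * max K 0 := mul_le_mul_of_nonneg_right ht1 (le_max_right _ _)
    _ = max K 0 := one_mul _

/-- **The t-derivative of the restricted interacting integrand** on the open branch `0 < t`, `te_k < 1`:
`(d/dt)[χ′_{Λ,t}·e^{−tW}] = (∂_tχ′_{Λ,t})·e^{−tW} + χ′_{Λ,t}·(e^{−tW}·(−W))`. [cite: BalabanImbrieJaffe1988, (5.14.3) p.309] -/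
theorem hasDerivAt_restrictedInteraction (p : ℝ) (B : Finset ι) (A c : ι → ℝ) (w : ℝ) {ek t : ℝ} (hek : 0 < ek) (ht : 0 < t)
    (h1 : t * ek < 1) :
    HasDerivAt (fun s => (∏ b ∈ B, cutoff χ (c b * pLog p (s * ek)) (A b)) * Real.exp (-(s * w)))
      (iteratedDeriv 1 (fun s => ∏ b ∈ B, cutoff χ (c b * pLog p (s * ek)) (A b)) t * Real.exp (-(t * w)) +
        (∏ b ∈ B, cutoff χ (c b * pLog p (t * ek)) (A b)) * (Real.exp (-(t * w)) * -w)) t := by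
  have hP := BIJ88RestrictionsAllOrders308.hasDerivAt_iteratedDeriv_prod_cutoff_t χ p B A c hek ht h1 0
  rw [iteratedDeriv_zero] at hP
  have hE : HasDerivAt (fun s => Real.exp (-(s * w))) (Real.exp (-(t * w)) * -w) t :=
    ((hasDerivAt_mul_const w).neg).exp
  exact hP.mul hE

end Integrand

/-! ## §2 Differentiation under the integral sign for `z(t) = ∫ χ′_{Λ,t} e^{−tW} dμ` -/

section UnderIntegral

variable (χ : CutoffProfile) {ι Ω : Type*} [MeasurableSpace Ω]

/-- **`z′(t₀)` for the restricted interacting family.**  For ANY finite measure μ, measurable fields `Φ_b`, thresholds `c_b ≠ 0`, a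
measurable interaction with `|W| ≤ K`, and `t₀` on the branch `0 < t₀`, `t₀e_k < e^{−1}`:
`z′(t₀) = ∫ [(∂_tχ′_{Λ,t})|_{t₀} e^{−t₀W} + χ′_{Λ,t₀}(e^{−t₀W}(−W))] dμ`, the integrand being integrable.
[cite: BalabanImbrieJaffe1988, (5.14.3) p.309] -/
theorem hasDerivAt_integral_restrictedInteraction (p : ℝ) (μ : Measure Ω) [IsFiniteMeasure μ] (B : Finset ι) {Φ : ι → Ω → ℝ}
    (hΦ : ∀ b ∈ B, Measurable (Φ b)) {c : ι → ℝ} (hc : ∀ b ∈ B, c b ≠ 0) {W : Ω → ℝ} (hW : Measurable W) {K : ℝ}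
    (hK : ∀ ω, |W ω| ≤ K) {ek t₀ : ℝ} (hek : 0 < ek) (ht₀ : 0 < t₀) (h1 : t₀ * ek < Real.exp (-1)) :
    Integrable (fun ω => iteratedDeriv 1 (fun s => ∏ b ∈ B, cutoff χ (c b * pLog p (s * ek)) (Φ b ω)) t₀ * Real.exp (-(t₀ * W ω)) +
        (∏ b ∈ B, cutoff χ (c b * pLog p (t₀ * ek)) (Φ b ω)) * (Real.exp (-(t₀ * W ω)) * -W ω)) μ ∧
      HasDerivAt (fun t => ∫ ω, (∏ b ∈ B, cutoff χ (c b * pLog p (t * ek)) (Φ b ω)) * Real.exp (-(t * W ω)) ∂μ)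
        (∫ ω, iteratedDeriv 1 (fun s => ∏ b ∈ B, cutoff χ (c b * pLog p (s * ek)) (Φ b ω)) t₀ * Real.exp (-(t₀ * W ω)) +
          (∏ b ∈ B, cutoff χ (c b * pLog p (t₀ * ek)) (Φ b ω)) * (Real.exp (-(t₀ * W ω)) * -W ω) ∂μ) t₀ := by
  classical
  set T : ℝ := Real.exp (-1) / ek with hT
  set s : Set ℝ := Set.Ioo (t₀ / 2) T with hs
  have ht₀T : t₀ < T := by rwa [hT, lt_div_iff₀ hek]
  have ht₀s : t₀ ∈ s := ⟨by linarith, ht₀T⟩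
  have hsn : s ∈ 𝓝 t₀ := isOpen_Ioo.mem_nhds ht₀s
  have hs_pos : ∀ x ∈ s, 0 < x := fun x hx => by linarith [hx.1]
  have hs_le : ∀ x ∈ s, x * ek ≤ Real.exp (-1) := fun x hx => by
    have := hx.2; rw [hT, lt_div_iff₀ hek] at this; exact this.le
  have hlt1 : ∀ x : ℝ, x * ek ≤ Real.exp (-1) → x * ek < 1 := fun x hx =>
    hx.trans_lt (by rw [← Real.exp_zero]; exact Real.exp_lt_exp.mpr (by norm_num))
  -- the exponential weight is bounded on s
  set K' : ℝ := max K 0 with hK'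
  have hexp : ∀ x ∈ s, ∀ ω, Real.exp (-(x * W ω)) ≤ Real.exp (T * K') := by
    intro x hx ω
    apply Real.exp_le_exp.mpr
    have h1' : -W ω ≤ K := (neg_le_abs _).trans (hK ω)
    have hx0 : 0 ≤ x := (hs_pos x hx).le
    have hKK : K ≤ K' := le_max_left _ _
    have hK'0 : 0 ≤ K' := le_max_right _ _
    calc -(x * W ω) = x * -W ω := by ring
      _ ≤ x * K' := mul_le_mul_of_nonneg_left (h1'.trans hKK) hx0
      _ ≤ T * K' := mul_le_mul_of_nonneg_right hx.2.le hK'0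
  -- the uniform constant for the first t-derivative of χ′
  obtain ⟨C, hC1, hC⟩ := BIJ88GaussIntegration309Product.abs_iteratedDeriv_prod_cutoff_t_le (ι := ι) χ p 1
  set Kb : ℝ := Real.exp (T * K') * ((B.card : ℝ) * C * (t₀ / 2)⁻¹ + K) with hKb
  set F : ℝ → Ω → ℝ := fun x ω => (∏ b ∈ B, cutoff χ (c b * pLog p (x * ek)) (Φ b ω)) * Real.exp (-(x * W ω)) with hF
  set F' : ℝ → Ω → ℝ := fun x ω =>
    iteratedDeriv 1 (fun s => ∏ b ∈ B, cutoff χ (c b * pLog p (s * ek)) (Φ b ω)) x * Real.exp (-(x * W ω)) +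
      (∏ b ∈ B, cutoff χ (c b * pLog p (x * ek)) (Φ b ω)) * (Real.exp (-(x * W ω)) * -W ω) with hF'
  have hF'meas : ∀ x ∈ s, Measurable (F' x) := by
    intro x hx
    have hm1 := BIJ88RestrictionsAllOrders308.measurable_iteratedDeriv_prod_cutoff_t χ p B hΦ c hek 1 (hs_pos x hx)
      (hlt1 x (hs_le x hx))
    have hm0 := BIJ88InterpolatedRestrictions308.measurable_prod_cutoff_t χ p B hΦ c ek x
    have hme : Measurable fun ω => Real.exp (-(x * W ω)) := Real.measurable_exp.comp (hW.const_mul x).neg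
    exact (hm1.mul hme).add (hm0.mul (hme.mul hW.neg))
  have hbound : ∀ ω, ∀ x ∈ s, ‖F' x ω‖ ≤ Kb := by
    intro ω x hx
    have hx0 : 0 < x := hs_pos x hx
    have hD := hC B (fun b => Φ b ω) c hc hek hx0 (hs_le x hx) 1 le_rfl
    rw [pow_one, show (-((1 : ℕ) : ℤ)) = -1 from rfl, zpow_neg_one] at hD
    have hxinv : x⁻¹ ≤ (t₀ / 2)⁻¹ := by rw [inv_le_inv₀ hx0 (by linarith)]; exact hx.1.le
    have hNC : 0 ≤ (B.card : ℝ) * C := mul_nonneg (Nat.cast_nonneg _) (by linarith)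
    have hD' : |iteratedDeriv 1 (fun s => ∏ b ∈ B, cutoff χ (c b * pLog p (s * ek)) (Φ b ω)) x| ≤
        (B.card : ℝ) * C * (t₀ / 2)⁻¹ := hD.trans (mul_le_mul_of_nonneg_left hxinv hNC)
    have hE := hexp x hx ω
    have hE0 : 0 < Real.exp (-(x * W ω)) := Real.exp_pos _
    have hP1 := BIJ88InterpolatedRestrictions308.abs_prod_cutoff_t_le_one χ p B (fun b => Φ b ω) c ek x
    rw [Real.norm_eq_abs, hF']
    calc |iteratedDeriv 1 (fun s => ∏ b ∈ B, cutoff χ (c b * pLog p (s * ek)) (Φ b ω)) x * Real.exp (-(x * W ω)) +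
          (∏ b ∈ B, cutoff χ (c b * pLog p (x * ek)) (Φ b ω)) * (Real.exp (-(x * W ω)) * -W ω)|
        ≤ |iteratedDeriv 1 (fun s => ∏ b ∈ B, cutoff χ (c b * pLog p (s * ek)) (Φ b ω)) x| * Real.exp (-(x * W ω)) +
          |∏ b ∈ B, cutoff χ (c b * pLog p (x * ek)) (Φ b ω)| * (Real.exp (-(x * W ω)) * |W ω|) := by
          refine (abs_add_le _ _).trans (le_of_eq ?_)
          rw [abs_mul, abs_mul, abs_mul, abs_neg, abs_of_pos hE0]
      _ ≤ (B.card : ℝ) * C * (t₀ / 2)⁻¹ * Real.exp (T * K') + 1 * (Real.exp (T * K') * K) := by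
          refine add_le_add ?_ ?_
          · exact mul_le_mul hD' hE hE0.le (mul_nonneg hNC (inv_nonneg.mpr (by linarith)))
          · exact mul_le_mul hP1 (mul_le_mul hE (hK ω) (abs_nonneg _) (Real.exp_pos _).le)
              (mul_nonneg hE0.le (abs_nonneg _)) zero_le_one
      _ = Kb := by rw [hKb]; ring
  refine hasDerivAt_integral_of_dominated_loc_of_deriv_le (F := F) (F' := F') (bound := fun _ => Kb) hsn ?_ ?_ ?_ ?_ ?_ ?_
  · exact Filter.Eventually.of_forall fun x => (measurable_restrictedInteraction χ p B hΦ c hW ek x).aestronglyMeasurable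
  · refine (integrable_const (Real.exp (t₀ * K))).mono'
      (measurable_restrictedInteraction χ p B hΦ c hW ek t₀).aestronglyMeasurable ?_
    exact Filter.Eventually.of_forall fun ω => by
      rw [Real.norm_eq_abs]; exact abs_restrictedInteraction_le χ p B (fun b => Φ b ω) c (hK ω) ht₀.le
  · exact (hF'meas t₀ ht₀s).aestronglyMeasurable
  · exact Filter.Eventually.of_forall fun ω x hx => hbound ω x hx
  · exact integrable_const Kb
  · exact Filter.Eventually.of_forall fun ω x hx =>
      hasDerivAt_restrictedInteraction χ p B (fun b => Φ b ω) c (W ω) hek (hs_pos x hx) (hlt1 x (hs_le x hx))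

end UnderIntegral

/-! ## §3 The limits `t → 0⁺` -/

section Limits

variable (χ : CutoffProfile) {ι Ω : Type*} [MeasurableSpace Ω]

/-- `t·e_k → 0⁺`-bookkeeping: `t ≤ 1`, `te_k < e^{−1}` and `0 < t` eventually in `𝓝[>] 0`. [cite: BalabanImbrieJaffe1988, (5.14.2) p.308] -/
theorem eventually_branch (ek : ℝ) :
    ∀ᶠ t in 𝓝[>] (0 : ℝ), 0 < t ∧ t ≤ 1 ∧ t * ek < Real.exp (-1) := by
  have h0 : Tendsto (fun t : ℝ => t) (𝓝[>] (0 : ℝ)) (𝓝 0) := tendsto_id.mono_left nhdsWithin_le_nhds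
  have h1 : Tendsto (fun t : ℝ => t * ek) (𝓝[>] (0 : ℝ)) (𝓝 0) := by
    have h := (tendsto_id.mul_const ek : Tendsto (fun t : ℝ => t * ek) (𝓝 0) (𝓝 (0 * ek)))
    rw [zero_mul] at h
    exact h.mono_left nhdsWithin_le_nhds
  filter_upwards [eventually_nhdsWithin_of_forall fun t ht => ht, h0.eventually (ge_mem_nhds zero_lt_one),
    h1.eventually (gt_mem_nhds (Real.exp_pos _))] with t ha hb hc
  exact ⟨ha, hb, hc⟩

/-- **`z(t) → μ(Ω)` as `t → 0⁺`** for the restricted interacting family (positive thresholds, `p > 0`, `|W| ≤ K`): both the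
restrictions and the interaction disappear at `t = 0`. [cite: BalabanImbrieJaffe1988, (5.14.2) p.308] -/
theorem tendsto_integral_restrictedInteraction_zero {p : ℝ} (hp : 0 < p) (μ : Measure Ω) [IsFiniteMeasure μ] (B : Finset ι)
    {Φ : ι → Ω → ℝ} (hΦ : ∀ b ∈ B, Measurable (Φ b)) {c : ι → ℝ} (hc : ∀ b ∈ B, 0 < c b) {W : Ω → ℝ} (hW : Measurable W)
    {K : ℝ} (hK : ∀ ω, |W ω| ≤ K) {ek : ℝ} (hek : 0 < ek) :
    Tendsto (fun t => ∫ ω, (∏ b ∈ B, cutoff χ (c b * pLog p (t * ek)) (Φ b ω)) * Real.exp (-(t * W ω)) ∂μ)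
      (𝓝[>] (0 : ℝ)) (𝓝 (μ.real Set.univ)) := by
  have hlim : Tendsto (fun t => ∫ ω, (∏ b ∈ B, cutoff χ (c b * pLog p (t * ek)) (Φ b ω)) * Real.exp (-(t * W ω)) ∂μ)
      (𝓝[>] (0 : ℝ)) (𝓝 (∫ _ : Ω, (1 : ℝ) ∂μ)) := by
    refine tendsto_integral_filter_of_dominated_convergence (fun _ => Real.exp (max K 0)) ?_ ?_ (integrable_const _) ?_
    · exact Filter.Eventually.of_forall fun t => (measurable_restrictedInteraction χ p B hΦ c hW ek t).aestronglyMeasurable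
    · filter_upwards [eventually_branch ek] with t ht
      refine Filter.Eventually.of_forall fun ω => ?_
      rw [Real.norm_eq_abs]
      rw [abs_mul, Real.abs_exp, ← one_mul (Real.exp (max K 0))]
      exact mul_le_mul (BIJ88InterpolatedRestrictions308.abs_prod_cutoff_t_le_one χ p B _ c ek t)
        (exp_neg_mul_le_exp_max (hK ω) ht.1.le ht.2.1) (Real.exp_pos _).le zero_le_one
    · refine Filter.Eventually.of_forall fun ω => ?_
      have hP := tendsto_finsetProd B (f := fun b t => cutoff χ (c b * pLog p (t * ek)) (Φ b ω)) (a := fun _ => (1 : ℝ))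
        (x := 𝓝[>] (0 : ℝ)) fun b hb => BIJ88RestrictionsVanish308.tendsto_cutoff_t_one χ (hc b hb) hp hek (Φ b ω)
      have hE : Tendsto (fun t : ℝ => Real.exp (-(t * W ω))) (𝓝[>] (0 : ℝ)) (𝓝 1) := by
        have h : Tendsto (fun t : ℝ => Real.exp (-(t * W ω))) (𝓝 0) (𝓝 (Real.exp (-(0 * W ω)))) :=
          (Real.continuous_exp.comp (continuous_id.mul continuous_const).neg).continuousAt.tendsto
        rw [zero_mul, neg_zero, Real.exp_zero] at h
        exact h.mono_left nhdsWithin_le_nhds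
      simpa using hP.mul hE
  rwa [integral_const, smul_eq_mul, mul_one] at hlim

/-- **The interaction term**: `∫ χ′_{Λ,t}·(e^{−tW}·(−W)) dμ → −∫ W dμ` as `t → 0⁺` (dominated convergence).
[cite: BalabanImbrieJaffe1988, (5.14.2) p.308] -/
theorem tendsto_integral_interactionTerm_zero {p : ℝ} (hp : 0 < p) (μ : Measure Ω) [IsFiniteMeasure μ] (B : Finset ι)
    {Φ : ι → Ω → ℝ} (hΦ : ∀ b ∈ B, Measurable (Φ b)) {c : ι → ℝ} (hc : ∀ b ∈ B, 0 < c b) {W : Ω → ℝ} (hW : Measurable W)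
    {K : ℝ} (hK : ∀ ω, |W ω| ≤ K) {ek : ℝ} (hek : 0 < ek) :
    Tendsto (fun t => ∫ ω, (∏ b ∈ B, cutoff χ (c b * pLog p (t * ek)) (Φ b ω)) * (Real.exp (-(t * W ω)) * -W ω) ∂μ)
      (𝓝[>] (0 : ℝ)) (𝓝 (-∫ ω, W ω ∂μ)) := by
  have hlim : Tendsto (fun t => ∫ ω, (∏ b ∈ B, cutoff χ (c b * pLog p (t * ek)) (Φ b ω)) * (Real.exp (-(t * W ω)) * -W ω) ∂μ)
      (𝓝[>] (0 : ℝ)) (𝓝 (∫ ω, -W ω ∂μ)) := by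
    refine tendsto_integral_filter_of_dominated_convergence (fun _ => Real.exp (max K 0) * K) ?_ ?_ (integrable_const _) ?_
    · exact Filter.Eventually.of_forall fun t =>
        ((BIJ88InterpolatedRestrictions308.measurable_prod_cutoff_t χ p B hΦ c ek t).mul
          ((Real.measurable_exp.comp (hW.const_mul t).neg).mul hW.neg)).aestronglyMeasurable
    · filter_upwards [eventually_branch ek] with t ht
      refine Filter.Eventually.of_forall fun ω => ?_
      have hP1 := BIJ88InterpolatedRestrictions308.abs_prod_cutoff_t_le_one χ p B (fun b => Φ b ω) c ek t
      have hE : Real.exp (-(t * W ω)) ≤ Real.exp (max K 0) := exp_neg_mul_le_exp_max (hK ω) ht.1.le ht.2.1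
      rw [Real.norm_eq_abs, abs_mul, abs_mul, abs_neg, Real.abs_exp]
      calc |∏ b ∈ B, cutoff χ (c b * pLog p (t * ek)) (Φ b ω)| * (Real.exp (-(t * W ω)) * |W ω|)
          ≤ 1 * (Real.exp (max K 0) * K) := by
            refine mul_le_mul hP1 (mul_le_mul hE (hK ω) (abs_nonneg _) (Real.exp_pos _).le) ?_ zero_le_one
            exact mul_nonneg (Real.exp_pos _).le (abs_nonneg _)
        _ = Real.exp (max K 0) * K := one_mul _
    · refine Filter.Eventually.of_forall fun ω => ?_
      have hP := tendsto_finsetProd B (f := fun b t => cutoff χ (c b * pLog p (t * ek)) (Φ b ω)) (a := fun _ => (1 : ℝ))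
        (x := 𝓝[>] (0 : ℝ)) fun b hb => BIJ88RestrictionsVanish308.tendsto_cutoff_t_one χ (hc b hb) hp hek (Φ b ω)
      have hE : Tendsto (fun t : ℝ => Real.exp (-(t * W ω)) * -W ω) (𝓝[>] (0 : ℝ)) (𝓝 (1 * -W ω)) := by
        have h : Tendsto (fun t : ℝ => Real.exp (-(t * W ω))) (𝓝 0) (𝓝 (Real.exp (-(0 * W ω)))) :=
          (Real.continuous_exp.comp (continuous_id.mul continuous_const).neg).continuousAt.tendsto
        rw [zero_mul, neg_zero, Real.exp_zero] at h
        exact (h.mono_left nhdsWithin_le_nhds).mul_const _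
      have := hP.mul hE
      simpa using this
  rwa [integral_neg] at hlim

/-- **The restriction term vanishes**: with CENTERED GAUSSIAN marginals (variances `≤ v`, `0 < v`), thresholds `|c_b| ≥ c₀ > 0`,
`p > 1/2`, `e_k > 0` and `|W| ≤ K`: `∫ (∂_tχ′_{Λ,t})·e^{−tW} dP → 0` as `t → 0⁺` — the Gaussian factor `t^{−1}e^{−κp(te_k)²}` of p. 309
beats the weight `e^{tK}`. [cite: BalabanImbrieJaffe1988, p.309 (Sect. 5.14)] -/
theorem tendsto_integral_restrictionTerm_zero {p : ℝ} (hp : 1 / 2 < p) (P : Measure Ω) [IsProbabilityMeasure P] (B : Finset ι)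
    {Φ : ι → Ω → ℝ} (hG : ∀ b ∈ B, HasGaussianLaw (Φ b) P) (hΦ : ∀ b ∈ B, Measurable (Φ b)) (h0 : ∀ b ∈ B, P[Φ b] = 0)
    {v : ℝ} (hv : 0 < v) (hvar : ∀ b ∈ B, Var[Φ b; P] ≤ v) {c : ι → ℝ} {c₀ : ℝ} (hc₀ : 0 < c₀) (hcb : ∀ b ∈ B, c₀ ≤ |c b|)
    (W : Ω → ℝ) {K : ℝ} (hK : ∀ ω, |W ω| ≤ K) {ek : ℝ} (hek : 0 < ek) :
    Tendsto (fun t => ∫ ω, iteratedDeriv 1 (fun s => ∏ b ∈ B, cutoff χ (c b * pLog p (s * ek)) (Φ b ω)) t *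
      Real.exp (-(t * W ω)) ∂P) (𝓝[>] (0 : ℝ)) (𝓝 0) := by
  obtain ⟨C, hC1, hC⟩ :=
    BIJ88GaussIntegration309Law.integral_abs_iteratedDeriv_prod_cutoff_t_le_of_hasGaussianLaw (ι := ι) (Ω := Ω) χ p 1
  have hκ : 0 < 81 / 200 * (c₀ ^ 2 / v) := by positivity
  have hcne : ∀ b ∈ B, c b ≠ 0 := fun b hb h => by have := hcb b hb; rw [h, abs_zero] at this; linarith
  -- |∫ D e^{-tW}| ≤ e^{max K 0} ∫ |D| ≤ e^{max K 0} (N C) t⁻¹ 2N e^{−κ p²}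
  refine squeeze_zero_norm' (a := fun t => Real.exp (max K 0) * ((B.card : ℝ) * C) * (2 * B.card) *
      (t ^ (-((1 : ℕ) : ℤ)) * Real.exp (-(81 / 200 * (c₀ ^ 2 / v) * pLog p (t * ek) ^ 2)))) ?_ ?_
  · filter_upwards [eventually_branch ek] with t ht
    have ht0 := ht.1
    have hlt1 : t * ek < 1 := ht.2.2.trans (by rw [← Real.exp_zero]; exact Real.exp_lt_exp.mpr (by norm_num))
    have hI := hC P B Φ c c₀ v hG hΦ h0 hv hvar hc₀ hcb hek ht0 ht.2.2.le 1 le_rfl le_rfl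
    have hE : ∀ ω, Real.exp (-(t * W ω)) ≤ Real.exp (max K 0) := fun ω => exp_neg_mul_le_exp_max (hK ω) ht0.le ht.2.1
    have hmeasD := BIJ88RestrictionsAllOrders308.measurable_iteratedDeriv_prod_cutoff_t χ p B hΦ c hek 1 ht0 hlt1
    -- pointwise: |D e^{-tW}| ≤ e^{max K 0} |D|
    have hpt : ∀ ω, |iteratedDeriv 1 (fun s => ∏ b ∈ B, cutoff χ (c b * pLog p (s * ek)) (Φ b ω)) t * Real.exp (-(t * W ω))|
        ≤ Real.exp (max K 0) * |iteratedDeriv 1 (fun s => ∏ b ∈ B, cutoff χ (c b * pLog p (s * ek)) (Φ b ω)) t| := by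
      intro ω
      rw [abs_mul, Real.abs_exp, mul_comm]
      exact mul_le_mul_of_nonneg_right (hE ω) (abs_nonneg _)
    -- integrability of |D| (bounded by (N C) t⁻¹, 309Product)
    obtain ⟨C', -, hC'⟩ := BIJ88GaussIntegration309Product.abs_iteratedDeriv_prod_cutoff_t_le (ι := ι) χ p 1
    have hDint : Integrable (fun ω => |iteratedDeriv 1 (fun s => ∏ b ∈ B, cutoff χ (c b * pLog p (s * ek)) (Φ b ω)) t|) P := by
      refine (integrable_const (((B.card : ℝ) * C') ^ 1 * t ^ (-((1 : ℕ) : ℤ)))).mono' hmeasD.abs.aestronglyMeasurable ?_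
      refine Filter.Eventually.of_forall fun ω => ?_
      rw [Real.norm_eq_abs, abs_abs]
      exact hC' B (fun b => Φ b ω) c hcne hek ht0 ht.2.2.le 1 le_rfl
    rw [Real.norm_eq_abs]
    calc |∫ ω, iteratedDeriv 1 (fun s => ∏ b ∈ B, cutoff χ (c b * pLog p (s * ek)) (Φ b ω)) t * Real.exp (-(t * W ω)) ∂P|
        ≤ ∫ ω, |iteratedDeriv 1 (fun s => ∏ b ∈ B, cutoff χ (c b * pLog p (s * ek)) (Φ b ω)) t * Real.exp (-(t * W ω))| ∂P :=
          abs_integral_le_integral_abs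
      _ ≤ ∫ ω, Real.exp (max K 0) * |iteratedDeriv 1 (fun s => ∏ b ∈ B, cutoff χ (c b * pLog p (s * ek)) (Φ b ω)) t| ∂P := by
          refine integral_mono_of_nonneg (Filter.Eventually.of_forall fun ω => abs_nonneg _) (hDint.const_mul _)
            (Filter.Eventually.of_forall fun ω => hpt ω)
      _ = Real.exp (max K 0) * ∫ ω, |iteratedDeriv 1 (fun s => ∏ b ∈ B, cutoff χ (c b * pLog p (s * ek)) (Φ b ω)) t| ∂P :=
          integral_const_mul _ _
      _ ≤ Real.exp (max K 0) * (((B.card : ℝ) * C) ^ 1 * t ^ (-((1 : ℕ) : ℤ)) *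
            (2 * B.card * Real.exp (-(81 / 200 * (c₀ ^ 2 / v) * pLog p (t * ek) ^ 2)))) :=
          mul_le_mul_of_nonneg_left hI (Real.exp_pos _).le
      _ = Real.exp (max K 0) * ((B.card : ℝ) * C) * (2 * B.card) *
            (t ^ (-((1 : ℕ) : ℤ)) * Real.exp (-(81 / 200 * (c₀ ^ 2 / v) * pLog p (t * ek) ^ 2))) := by ring
  · have h := (BIJ88RestrictionsAllOrders308.tendsto_zpow_mul_exp_neg_pLog_sq hκ hp hek 1).const_mul
      (Real.exp (max K 0) * ((B.card : ℝ) * C) * (2 * B.card))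
    rw [mul_zero] at h
    exact h

end Limits

/-! ## §4 The first perturbative term: `(d/dt) log z_t → −∫ W dP` as `t → 0⁺` -/

section FirstTerm

variable (χ : CutoffProfile) {ι Ω : Type*} [MeasurableSpace Ω]

/-- **`z′(t) → −∫ W dP` as `t → 0⁺`** for the restricted interacting family with centered Gaussian marginals, positive thresholds
`c_b ≥ c₀ > 0`, `p > 1/2`, `|W| ≤ K`. [cite: BalabanImbrieJaffe1988, (5.14.1) p.308] -/
theorem tendsto_deriv_integral_restrictedInteraction_zero {p : ℝ} (hp : 1 / 2 < p) (P : Measure Ω) [IsProbabilityMeasure P]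
    (B : Finset ι) {Φ : ι → Ω → ℝ} (hG : ∀ b ∈ B, HasGaussianLaw (Φ b) P) (hΦ : ∀ b ∈ B, Measurable (Φ b))
    (h0 : ∀ b ∈ B, P[Φ b] = 0) {v : ℝ} (hv : 0 < v) (hvar : ∀ b ∈ B, Var[Φ b; P] ≤ v) {c : ι → ℝ} {c₀ : ℝ} (hc₀ : 0 < c₀)
    (hcb : ∀ b ∈ B, c₀ ≤ c b) {W : Ω → ℝ} (hW : Measurable W) {K : ℝ} (hK : ∀ ω, |W ω| ≤ K) {ek : ℝ} (hek : 0 < ek) :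
    Tendsto (fun t => deriv (fun t => ∫ ω, (∏ b ∈ B, cutoff χ (c b * pLog p (t * ek)) (Φ b ω)) * Real.exp (-(t * W ω)) ∂P) t)
      (𝓝[>] (0 : ℝ)) (𝓝 (-∫ ω, W ω ∂P)) := by
  have hp0 : 0 < p := by linarith
  have hcpos : ∀ b ∈ B, 0 < c b := fun b hb => hc₀.trans_le (hcb b hb)
  have hcne : ∀ b ∈ B, c b ≠ 0 := fun b hb => (hcpos b hb).ne'
  have hcabs : ∀ b ∈ B, c₀ ≤ |c b| := fun b hb => (hcb b hb).trans (le_abs_self _)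
  have hR := tendsto_integral_restrictionTerm_zero χ hp P B hG hΦ h0 hv hvar hc₀ hcabs W hK hek
  have hI := tendsto_integral_interactionTerm_zero χ hp0 P B hΦ hcpos hW hK hek
  have hsum := hR.add hI
  rw [zero_add] at hsum
  refine hsum.congr' ?_
  filter_upwards [eventually_branch ek] with t ht
  have hmain := hasDerivAt_integral_restrictedInteraction χ p P B hΦ hcne hW hK hek ht.1 ht.2.2
  rw [hmain.2.deriv]
  -- split the integral of the sum
  have hlt1 : t * ek < 1 := ht.2.2.trans (by rw [← Real.exp_zero]; exact Real.exp_lt_exp.mpr (by norm_num))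
  have hme : Measurable fun ω => Real.exp (-(t * W ω)) := Real.measurable_exp.comp (hW.const_mul t).neg
  have hm0 := BIJ88InterpolatedRestrictions308.measurable_prod_cutoff_t χ p B hΦ c ek t
  have hE : ∀ ω, Real.exp (-(t * W ω)) ≤ Real.exp (max K 0) := fun ω => exp_neg_mul_le_exp_max (hK ω) ht.1.le ht.2.1
  have hint2 : Integrable (fun ω => (∏ b ∈ B, cutoff χ (c b * pLog p (t * ek)) (Φ b ω)) * (Real.exp (-(t * W ω)) * -W ω)) P := by
    refine (integrable_const (Real.exp (max K 0) * K)).mono' ((hm0.mul (hme.mul hW.neg)).aestronglyMeasurable) ?_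
    refine Filter.Eventually.of_forall fun ω => ?_
    have hP1 := BIJ88InterpolatedRestrictions308.abs_prod_cutoff_t_le_one χ p B (fun b => Φ b ω) c ek t
    rw [Real.norm_eq_abs, abs_mul, abs_mul, abs_neg, Real.abs_exp]
    calc |∏ b ∈ B, cutoff χ (c b * pLog p (t * ek)) (Φ b ω)| * (Real.exp (-(t * W ω)) * |W ω|)
        ≤ 1 * (Real.exp (max K 0) * K) := by
          refine mul_le_mul hP1 (mul_le_mul (hE ω) (hK ω) (abs_nonneg _) (Real.exp_pos _).le) ?_ zero_le_one
          exact mul_nonneg (Real.exp_pos _).le (abs_nonneg _)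
      _ = Real.exp (max K 0) * K := one_mul _
  have hint1 : Integrable (fun ω => iteratedDeriv 1 (fun s => ∏ b ∈ B, cutoff χ (c b * pLog p (s * ek)) (Φ b ω)) t *
      Real.exp (-(t * W ω))) P := by
    have h := hmain.1.sub hint2
    refine h.congr (Filter.Eventually.of_forall fun ω => ?_)
    simp only [Pi.sub_apply, add_sub_cancel_right]
  exact (integral_add hint1 hint2).symm

/-- **(5.14.1), α = 1, with the restrictions included: `(d/dt) log z_t → −∫ W dP = ⟨−Ṽ⟩_{t=0}` as `t → 0⁺`.**  For a probability
measure with CENTERED GAUSSIAN marginals `Φ_b` (Mathlib `HasGaussianLaw`, variances `≤ v`), positive thresholds `c_b ≥ c₀ > 0`,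
`p > 1/2`, `e_k > 0`, and a measurable interaction `|W| ≤ K`: the first perturbative term of `z_t = ∫ χ′_{Λ,t} e^{−tW} dP` is the
Gaussian expectation of `−W`; the restrictions contribute nothing. [cite: BalabanImbrieJaffe1988, (5.14.1) p.308] -/
theorem tendsto_deriv_log_restrictedInteraction_zero {p : ℝ} (hp : 1 / 2 < p) (P : Measure Ω) [IsProbabilityMeasure P]
    (B : Finset ι) {Φ : ι → Ω → ℝ} (hG : ∀ b ∈ B, HasGaussianLaw (Φ b) P) (hΦ : ∀ b ∈ B, Measurable (Φ b))
    (h0 : ∀ b ∈ B, P[Φ b] = 0) {v : ℝ} (hv : 0 < v) (hvar : ∀ b ∈ B, Var[Φ b; P] ≤ v) {c : ι → ℝ} {c₀ : ℝ} (hc₀ : 0 < c₀)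
    (hcb : ∀ b ∈ B, c₀ ≤ c b) {W : Ω → ℝ} (hW : Measurable W) {K : ℝ} (hK : ∀ ω, |W ω| ≤ K) {ek : ℝ} (hek : 0 < ek) :
    Tendsto (fun t => deriv (fun t => Real.log
        (∫ ω, (∏ b ∈ B, cutoff χ (c b * pLog p (t * ek)) (Φ b ω)) * Real.exp (-(t * W ω)) ∂P)) t)
      (𝓝[>] (0 : ℝ)) (𝓝 (-∫ ω, W ω ∂P)) := by
  have hp0 : 0 < p := by linarith
  have hcpos : ∀ b ∈ B, 0 < c b := fun b hb => hc₀.trans_le (hcb b hb)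
  have hcne : ∀ b ∈ B, c b ≠ 0 := fun b hb => (hcpos b hb).ne'
  set z : ℝ → ℝ := fun t => ∫ ω, (∏ b ∈ B, cutoff χ (c b * pLog p (t * ek)) (Φ b ω)) * Real.exp (-(t * W ω)) ∂P with hz
  have hz1 : Tendsto z (𝓝[>] (0 : ℝ)) (𝓝 1) := by
    have h := tendsto_integral_restrictedInteraction_zero χ hp0 P B hΦ hcpos hW hK hek
    rwa [probReal_univ] at h
  have hz' := tendsto_deriv_integral_restrictedInteraction_zero χ hp P B hG hΦ h0 hv hvar hc₀ hcb hW hK hek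
  have hdiv := hz'.div hz1 one_ne_zero
  rw [div_one] at hdiv
  refine hdiv.congr' ?_
  have hzne : ∀ᶠ t in 𝓝[>] (0 : ℝ), z t ≠ 0 :=
    (hz1.eventually (lt_mem_nhds (by norm_num : (1 : ℝ) / 2 < 1))).mono fun t ht h => by rw [h] at ht; linarith
  filter_upwards [eventually_branch ek, hzne] with t ht hzt
  have hmain := (hasDerivAt_integral_restrictedInteraction χ p P B hΦ hcne hW hK hek ht.1 ht.2.2).2
  rw [Pi.div_apply, (hmain.log hzt).deriv, hmain.deriv]

end FirstTerm

end Literature.MathematicalPhysics.QuantumFieldTheory.BalabanImbrieJaffe1984to88.BIJ88RestrictedInteraction308
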